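import Summits.CriticalPhenomena.SAWScalingLimit.Theorems.BoundaryTP2.Negative.TP2CertKit
import Summits.CriticalPhenomena.SAWScalingLimit.Theorems.SAWTotalPositivityBoundaryTP2Symmetry
import Summits.CriticalPhenomena.SAWScalingLimit.Theorems.SAWTotalPositivityBoundaryTP2Kernel
import HarnessLib

/-!
# Crux `BoundaryTP2` (stmt-CriticalPhenomena-7115): the certificate kit at graph level (arbitrary site lists)

Certified-compute seat (refuter `ccert`), part 4.  Parts 2–3 are tied to boxes; here the same two kernel
computations are set up for the graph `ℤ²[VS]` INDUCED on an arbitrary duplicate-free list of sites `VS`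
(L-shapes, slit boxes, …), abstractly: any `G` with `G.Adj x y ↔ (zdGraph 2).Adj x y ∧ x ∈ VS ∧ y ∈ VS`
(boxes: `adj_rect_iff`; general lattice-connected `VS`: the realisation `realise a b V` of
`…BoundaryHarnackRealisation`, see `TP2CertRealise`).  `pathsV VS u v` enumerates the supports of the
self-avoiding paths `u → v` (complete: `support_mem_pathsV`; sound: `exists_path_of_mem_pathsV`; duplicate-free:
`pathsV_nodup`), `pathCountV VS u v` is the exact coefficient vector of the path kernel
(`pathKernel_eq_evPolyV`), and `tp2_graph_of_certAll` turns a table of such vectors plus a passing `certAll`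
(part 1) into the circular TP₂ inequalities for `pathKernel G x`, `x ∈ [10/27, 5/13]`.  Everything proved. [folklore]
-/

namespace Summit.CriticalPhenomena.SAWScalingLimit.Theorems.BoundaryTP2.Negative.Cert

open Literature.Probability.LatticeModels Literature.Probability.RandomPlanarGeometry
open Summit.CriticalPhenomena.SAWScalingLimit.Theorems.EdgeOfPositivity.Negative
open Summit.CriticalPhenomena.SAWScalingLimit.Theorems.BoundaryTP2
open scoped ENNReal

/-! ## §1 The enumerator on a site list -/

section Graph

variable (VS : List (Site 2))

/-- Lattice neighbours inside the site list. [folklore] -/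
def nbrV (v : Site 2) : List (Site 2) := VS.filter fun w => (zdGraph 2).Adj v w

/-- All supports of self-avoiding paths `u → v` of `ℤ²[VS]` (kernel-evaluable). [folklore] -/
def pathsV (u v : Site 2) : List (List (Site 2)) := allPaths (nbrV VS) v (VS.length - 1) u []

/-- The exact coefficient vector of the path kernel: entry `k` = number of `k`-step paths `u → v`. [folklore] -/
def pathCountV (u v : Site 2) : List ℕ := hist ((pathsV VS u v).map fun L => L.length - 1)

variable {VS} {G : SimpleGraph (Site 2)}

/-- Membership in the neighbour lists. [folklore] -/
theorem mem_nbrV_iff {v w : Site 2} : w ∈ nbrV VS v ↔ w ∈ VS ∧ (zdGraph 2).Adj v w := by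
  simp [nbrV, List.mem_filter]

/-- A walk of `G` issued from a listed site stays in the list. [folklore] -/
theorem forall_mem_support_of_walk (hG : ∀ x y, G.Adj x y ↔ (zdGraph 2).Adj x y ∧ x ∈ VS ∧ y ∈ VS)
    {u v : Site 2} (hu : u ∈ VS) (p : G.Walk u v) : ∀ w ∈ p.support, w ∈ VS := by
  induction p with
  | nil => intro w hw; rw [SimpleGraph.Walk.support_nil, List.mem_singleton] at hw; exact hw ▸ hu
  | cons h q ih =>
    intro w hw
    rw [SimpleGraph.Walk.support_cons, List.mem_cons] at hw
    rcases hw with rfl | hw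
    · exact hu
    · exact ih ((hG _ _).1 h).2.2 w hw

/-- **Completeness.** The support of every self-avoiding path of `G` from a listed site is enumerated. [folklore] -/
theorem support_mem_pathsV (hG : ∀ x y, G.Adj x y ↔ (zdGraph 2).Adj x y ∧ x ∈ VS ∧ y ∈ VS)
    {u v : Site 2} (hu : u ∈ VS) (p : G.Walk u v) (hp : p.IsPath) :
    p.support ∈ pathsV VS u v := by
  have hsup : p.support = u :: p.support.tail := (p.cons_tail_support).symm
  rw [pathsV, hsup]
  apply mem_allPaths
  · exact follows_support_tail (nbrV VS) (fun a b h => mem_nbrV_iff.2 ⟨((hG a b).1 h).2.2, ((hG a b).1 h).1⟩) p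
  · rw [← hsup]; exact hp.support_nodup
  · intro w _; exact List.not_mem_nil
  · have h1 : (u :: p.support.tail).getLast (List.cons_ne_nil _ _) = p.support.getLast p.support_ne_nil := by
      congr 1; exact hsup.symm
    rw [h1, SimpleGraph.Walk.getLast_support]
  · have hsub : p.support ⊆ VS := fun w hw => forall_mem_support_of_walk hG hu p w hw
    have hlen : p.support.length ≤ VS.length := (List.subperm_of_subset hp.support_nodup hsub).length_le
    have : (u :: p.support.tail).length ≤ VS.length := by rw [← hsup]; exact hlen
    rw [List.length_cons] at this
    omega

/-- **Soundness.** Every enumerated list is the support of a self-avoiding path of `G`. [folklore] -/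
theorem exists_path_of_mem_pathsV (hG : ∀ x y, G.Adj x y ↔ (zdGraph 2).Adj x y ∧ x ∈ VS ∧ y ∈ VS)
    {u v : Site 2} {L : List (Site 2)} (hu : u ∈ VS) (hL : L ∈ pathsV VS u v) :
    ∃ p : G.Walk u v, p.IsPath ∧ p.support = L := by
  obtain ⟨rest, rfl, hf, hnd, -, hlast⟩ := allPaths_sound (nbrV VS) v _ u [] L hL
  have hadj : ∀ x y : Site 2, x ∈ {w | w ∈ VS} → y ∈ nbrV VS x → G.Adj x y :=
    fun x y hx hy => (hG x y).2 ⟨(mem_nbrV_iff.1 hy).2, hx, (mem_nbrV_iff.1 hy).1⟩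
  have hS : ∀ x y : Site 2, x ∈ {w | w ∈ VS} → y ∈ nbrV VS x → y ∈ {w | w ∈ VS} :=
    fun x y _ hy => (mem_nbrV_iff.1 hy).1
  subst hlast
  exact ⟨walkOf (nbrV VS) {w | w ∈ VS} hadj hS u rest hu hf,
    SimpleGraph.Walk.IsPath.mk' (by rw [support_walkOf]; exact hnd), support_walkOf _ _ _ _ _ _ _ _⟩

/-- The enumeration has no duplicates. [folklore] -/
theorem pathsV_nodup (hVS : VS.Nodup) (u v : Site 2) : (pathsV VS u v).Nodup :=
  allPaths_nodup _ (fun _ => hVS.filter _) _ _ _ _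

/-- **The path kernel as the finite sum over the enumeration.** [folklore] -/
theorem pathKernel_eq_sum_pathsV (hG : ∀ x y, G.Adj x y ↔ (zdGraph 2).Adj x y ∧ x ∈ VS ∧ y ∈ VS)
    (hVS : VS.Nodup) {u v : Site 2} (hu : u ∈ VS) (x : ℝ) :
    pathKernel G x u v = ((pathsV VS u v).map (listWeight x)).sum := by
  classical
  rw [← List.sum_toFinset _ (pathsV_nodup hVS u v)]
  set S := (pathsV VS u v).toFinset with hSdef
  have hmemS : ∀ γ : G.Path u v, γ.1.support ∈ S := fun γ =>
    List.mem_toFinset.2 (support_mem_pathsV hG hu γ.1 γ.2)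
  have hw : ∀ γ : G.Path u v, ENNReal.ofReal (x ^ γ.1.length) = listWeight x γ.1.support := fun γ => by
    rw [listWeight, SimpleGraph.Walk.length_support]; rfl
  refine le_antisymm ?_ ?_
  · -- injection `γ ↦ support`
    let f : G.Path u v → ↥S := fun γ => ⟨γ.1.support, hmemS γ⟩
    have hf : Function.Injective f := fun γ γ' h =>
      Subtype.ext (SimpleGraph.Walk.support_injective (congrArg Subtype.val h))
    calc pathKernel G x u v = ∑' γ : G.Path u v, (fun b : ↥S => listWeight x b.1) (f γ) := by
          rw [pathKernel]; exact tsum_congr fun γ => hw γ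
      _ ≤ ∑' b : ↥S, listWeight x b.1 := ENNReal.tsum_comp_le_tsum_of_injective hf _
      _ = ∑ L ∈ S, listWeight x L := by rw [tsum_fintype, Finset.sum_coe_sort]
  · -- injection `L ↦ path with support L`
    have hex : ∀ L : ↥S, ∃ p : G.Walk u v, p.IsPath ∧ p.support = L.1 := fun L =>
      exists_path_of_mem_pathsV hG hu (List.mem_toFinset.1 L.2)
    choose pth hpth hsupp using hex
    let g : ↥S → G.Path u v := fun L => ⟨pth L, hpth L⟩
    have hg : Function.Injective g := fun L L' h => by
      apply Subtype.ext
      rw [← hsupp L, ← hsupp L']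
      exact congrArg (fun γ : G.Path u v => γ.1.support) h
    calc ∑ L ∈ S, listWeight x L = ∑' L : ↥S, listWeight x L.1 := by rw [tsum_fintype, Finset.sum_coe_sort]
      _ = ∑' L : ↥S, (fun γ : G.Path u v => ENNReal.ofReal (x ^ γ.1.length)) (g L) := by
          refine tsum_congr fun L => ?_
          show listWeight x L.1 = ENNReal.ofReal (x ^ (pth L).length)
          rw [hw ⟨pth L, hpth L⟩]
          exact congrArg (listWeight x) (hsupp L).symm
      _ ≤ pathKernel G x u v := ENNReal.tsum_comp_le_tsum_of_injective hg _

/-- **Exact path kernel from the coefficient vector.** [folklore] -/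
theorem pathKernel_eq_evPolyV (hG : ∀ x y, G.Adj x y ↔ (zdGraph 2).Adj x y ∧ x ∈ VS ∧ y ∈ VS)
    (hVS : VS.Nodup) {u v : Site 2} (hu : u ∈ VS) {x : ℝ} (hx : 0 ≤ x) :
    pathKernel G x u v = ENNReal.ofReal (evPoly (pathCountV VS u v) x) := by
  rw [pathKernel_eq_sum_pathsV hG hVS hu, pathCountV, evPoly_hist, ← sum_map_ofReal_pow hx, List.map_map]
  rfl

end Graph

/-! ## §2 Circular TP₂ for listed sites from the certificate -/

/-- Table lookup agrees with the tabulated function on the listed pairs (generic form of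
`cf_eq_pathCount`). [folklore] -/
theorem cf_eq_apply {F : Site 2 × Site 2 → List ℕ} {bd : List (Site 2)} {ctab : List (List (List ℕ))}
    (hct : (rowsOf bd).map (List.map F) = ctab) {i j : ℕ} (hij : i < j) (hj : j < bd.length) :
    cf ctab i j = F (bd.getD i 0, bd.getD j 0) := by
  obtain ⟨h1, h2⟩ := rowsOf_getD (0 : Site 2) bd i (j - i - 1) (by omega)
  rw [show i + 1 + (j - i - 1) = j by omega] at h1
  have ht : j - i - 1 < ((rowsOf bd).getD i []).length := by rw [h2]; omega
  rw [cf, ← hct, show ([] : List (List ℕ)) = List.map F [] from rfl, List.getD_map,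
    List.getD_eq_getElem _ _ (by simpa using ht), List.getElem_map,
    ← List.getD_eq_getElem _ ((0 : Site 2), (0 : Site 2)) ht, h1]

/-- **Circular TP₂ for a list of sites of `ℤ²[VS]` from the certificate** (both non-crossing pairings dominate
the crossing one, all `i < j < k < l`, all `x ∈ [10/27, 5/13]`). [folklore] -/
theorem tp2_graph_of_certAll {VS : List (Site 2)} {G : SimpleGraph (Site 2)}
    (hG : ∀ x y, G.Adj x y ↔ (zdGraph 2).Adj x y ∧ x ∈ VS ∧ y ∈ VS) (hVS : VS.Nodup)
    {bd : List (Site 2)} (hbd : ∀ u ∈ bd, u ∈ VS) {ctab : List (List (List ℕ))}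
    (hct : (rowsOf bd).map (List.map fun p : Site 2 × Site 2 => pathCountV VS p.1 p.2) = ctab)
    {K F : ℕ} (hcert : certAll bd.length K F ctab = true) {x : ℝ} (hlo : 10 / 27 ≤ x) (hhi : x ≤ 5 / 13)
    {i j k l : ℕ} (hij : i < j) (hjk : j < k) (hkl : k < l) (hl : l < bd.length) :
    pathKernel G x (bd.getD i 0) (bd.getD k 0) * pathKernel G x (bd.getD j 0) (bd.getD l 0) ≤
        pathKernel G x (bd.getD i 0) (bd.getD j 0) * pathKernel G x (bd.getD k 0) (bd.getD l 0) ∧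
      pathKernel G x (bd.getD i 0) (bd.getD k 0) * pathKernel G x (bd.getD j 0) (bd.getD l 0) ≤
        pathKernel G x (bd.getD i 0) (bd.getD l 0) * pathKernel G x (bd.getD j 0) (bd.getD k 0) := by
  have hx : 0 ≤ x := le_trans (by norm_num) hlo
  have hmem : ∀ n, n < bd.length → bd.getD n 0 ∈ VS := fun n hn => by
    rw [List.getD_eq_getElem _ _ hn]; exact hbd _ (List.getElem_mem hn)
  have hZ : ∀ {s t : ℕ}, s < t → t < bd.length →
      pathKernel G x (bd.getD s 0) (bd.getD t 0) = ENNReal.ofReal (evPoly (cf ctab s t) x) := by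
    intro s t hst ht
    rw [pathKernel_eq_evPolyV hG hVS (hmem s (hst.trans ht)) hx, cf_eq_apply hct hst ht]
  obtain ⟨h1, h2⟩ := poly_of_certAll hcert hij hjk hkl hl hlo hhi
  have hik : i < k := hij.trans hjk
  have hjl : j < l := hjk.trans hkl
  have hil : i < l := hik.trans hkl
  have hk : k < bd.length := hkl.trans hl
  have hj : j < bd.length := hjk.trans hk
  rw [hZ hik hk, hZ hjl hl, hZ hij hj, hZ hkl hl, hZ hil hl, hZ hjk hk,
    ← ENNReal.ofReal_mul (evPoly_nonneg _ hx), ← ENNReal.ofReal_mul (evPoly_nonneg _ hx),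
    ← ENNReal.ofReal_mul (evPoly_nonneg _ hx)]
  exact ⟨ENNReal.ofReal_le_ofReal h1, ENNReal.ofReal_le_ofReal h2⟩

/-- Boolean membership of all entries of one list in another (a `decide`). [folklore] -/
theorem forall_mem_of_all_elem {bd VS : List (Site 2)} (h : (bd.all fun u => decide (u ∈ VS)) = true) :
    ∀ u ∈ bd, u ∈ VS := fun u hu => by
  have := List.all_eq_true.1 h u hu
  simpa using this

end Summit.CriticalPhenomena.SAWScalingLimit.Theorems.BoundaryTP2.Negative.Cert
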